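import Summits.HodgeConjecture.HodgeConjecture.Theses.AnchorTransport

/-!
# Route AnchorTransport — objects the route posits (definitions): the CHAIN normal form of `AnchorExistence`

Definitions used by the `--supports` files of the crux `AnchorExistence` (stmt-HodgeConjecture-1077) on the
line `Sketch-peel-to-zero` (card `Cruxes/AnchorExistence/Ideas/peel-to-zero-chain-anchors.md`, crux workfile
`Cruxes/AnchorExistence/Lines/Sketch_peel_to_zero.lean`, lead a2 2026-08-17):

* `ChainAnchor.HodgePair n p` — a smooth projective complex variety `X` of dimension `n` with a rational
  class `c ∈ H²ᵖ(X(ℂ); ℂ)` of Hodge type `(p,p)` (one instance of the hypotheses of the crux);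
* `ChainAnchor.Hop P Q` — `P` and `Q` are two fibres-with-class of ONE smooth projective family over a
  smooth irreducible `ℂ`-scheme carrying ONE global class, fibrewise rational of type `(p,p)` (the `∃`-body
  of `AnchorExistence` with the algebraicity clause replaced by a second marked fibre);
* `ChainAnchor.Surgery P Q` — across an iso `P.X ≅ Q.X` the classes differ by an algebraic class;
* `ChainAnchor.Step := Hop ∨ Surgery`; `ChainAnchor.ChainAnchorAt P` — a finite chain of steps from `P`
  reaches a pair with algebraic class; `ChainAnchor.Stuck P` — every pair reachable from `P` is `P` up to
  an iso and an algebraic difference; `ChainAnchor.ChainAnchorExistenceAt n p` — every Hodge pair in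
  bidegree `(n, p)` is chain-anchored (the card's weakening `C⁺` of the crux is `∀ n p, ChainAnchorExistenceAt n p`,
  kept unabbreviated: a parameterless `def … : Prop` in a Summits file is a Literature fact by the gate's rules);
* `ChainAnchor.fiberPair f hf A hA u` — the pair `(𝒳_u, A|_{𝒳_u})` carried by a fibre.

These are route-posited STATEMENTS (hypothesis shapes of the line's registered stubs
`anchorExistence_stub_chain_movable : ∀ n p P, ¬ Stuck P → ChainAnchorAt P` and
`anchorExistence_stub_chain_stuck : ∀ n p P, Stuck P → ChainAnchorAt P`), not results of the
literature; apart from the unfolding lemma `chainAnchorExistenceAt_iff` the theorems about them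
(`AnchorExistence → ∀ n p, ChainAnchorExistenceAt n p`; `VariationalHodge → (∀ n p, ChainAnchorExistenceAt n p) →
AnchorExistence`; the residue certificate "on stuck pairs chain-anchored ↔ algebraic") live in the sibling
proof file `AnchorTransportAnchorExistenceChain`.

## References

* [CharlesSchnell2014Notes] F. Charles, C. Schnell, Notes on absolute Hodge classes, §11.3 (Conj. 11.3.1,
  Prop. 11.3.5, Cor. 11.3.6: the variational Hodge conjecture).
* [Deligne2000] P. Deligne, The Hodge conjecture (Clay problem description), §1.
* [BaldiKlinglerUllmo2024] G. Baldi, B. Klingler, E. Ullmo, On the distribution of the Hodge locus,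
  Thm. 2.3 (atypical Hodge loci in level ≥ 3).
-/

noncomputable section

-- `Summit.HodgeConjecture.HodgeConjecture.Theorems` is the mandated namespace (single-problem summit:
-- Problem = Summit), which `linter.dupNamespace` flags; restated so stand-alone elaboration is warning-free.
set_option linter.dupNamespace false

namespace Summit.HodgeConjecture.HodgeConjecture.Theorems.ChainAnchor

open CategoryTheory AlgebraicGeometry
open Literature.AlgebraicGeometry.Motives Literature.AlgebraicGeometry.HodgeTheory

/-- A **Hodge pair** `(X, c)`: a smooth projective complex variety `X` of dimension `n` together with a
rational class `c ∈ H²ᵖ(X(ℂ); ℂ)` of Hodge type `(p,p)` — one instance of the hypotheses of the Hodge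
conjecture and of the crux `AnchorTransport.AnchorExistence`. [cite: Deligne2000, §1] -/
structure HodgePair (n p : ℕ) where
  /-- the variety -/
  X : SchemeOver ℂ
  /-- the class in `H²ᵖ(X(ℂ); ℂ)` -/
  c : complexBetti X (2 * p)
  /-- `X` is smooth projective of dimension `n` -/
  isSmoothProjective : IsSmoothProjective n X
  /-- `c` is a rational class -/
  isRationalClass : IsRationalClass c
  /-- `c` is of Hodge type `(p,p)` -/
  isOfHodgeType : IsOfHodgeType n X (2 * p) p p c

variable {n p : ℕ}

/-- A **hop** from `P` to `Q`: both pairs are fibres-with-class of ONE smooth projective family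
`f : 𝒳 ⟶ S` of relative dimension `n` over a smooth irreducible `ℂ`-scheme carrying ONE global class
`A ∈ H²ᵖ(𝒳(ℂ); ℂ)` that is fibrewise rational of type `(p,p)`, with `e^*(A|_{𝒳_s}) = P.c` and
`e'^*(A|_{𝒳_t}) = Q.c` — the `∃`-body of `AnchorExistence` with the algebraicity clause at the second
fibre replaced by a second marked pair. [cite: CharlesSchnell2014Notes, Conj. 11.3.1] -/
def Hop (P Q : HodgePair n p) : Prop :=
  ∃ (𝒳 S : SchemeOver ℂ) (f : 𝒳 ⟶ S) (s t : ComplexPoints S) (e : P.X ≅ fiberOver f s)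
    (e' : Q.X ≅ fiberOver f t) (A : complexBetti 𝒳 (2 * p)),
    IsSmoothProjectiveFamily f n ∧ IrreducibleSpace S.left ∧ AlgebraicGeometry.Smooth S.hom ∧
    (∀ u : ComplexPoints S, IsRationalClass (complexBetti.map (fiberι f u) (2 * p) A) ∧
      IsOfHodgeType n (fiberOver f u) (2 * p) p p (complexBetti.map (fiberι f u) (2 * p) A)) ∧
    complexBetti.map e.hom (2 * p) (complexBetti.map (fiberι f s) (2 * p) A) = P.c ∧
    complexBetti.map e'.hom (2 * p) (complexBetti.map (fiberι f t) (2 * p) A) = Q.c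

/-- A **surgery** from `P` to `Q`: across an iso `e : P.X ≅ Q.X` the classes differ by an ALGEBRAIC
class, `P.c - e^*(Q.c) ∈ algebraicClasses P.X p` (subtracting a cycle-explained class at a special
member: a class that is algebraic by construction). [cite: Deligne2000, §1] -/
def Surgery (P Q : HodgePair n p) : Prop :=
  ∃ e : P.X ≅ Q.X, P.c - complexBetti.map e.hom (2 * p) Q.c ∈ algebraicClasses P.X p

/-- One **step** of a chain: a hop or a surgery. [cite: Deligne2000, §1] -/
def Step (P Q : HodgePair n p) : Prop :=
  Hop P Q ∨ Surgery P Q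

/-- `P` is **chain-anchored**: a finite chain of hops and surgeries from `P` (Mathlib's reflexive–transitive
closure `Relation.ReflTransGen Step`) reaches a pair whose class is algebraic.
[cite: CharlesSchnell2014Notes, Conj. 11.3.1] -/
def ChainAnchorAt (P : HodgePair n p) : Prop :=
  ∃ Q : HodgePair n p, Relation.ReflTransGen Step P Q ∧ Q.c ∈ algebraicClasses Q.X p

/-- `P` is **stuck**: every pair reachable from `P` by hops and surgeries is `P` again up to an
isomorphism `g : Q.X ≅ P.X` and an algebraic difference `Q.c - g^*(P.c)` — no chain leaves the pair modulo
isos and algebraic classes (the shape taken, e.g., by pairs with `P.X` infinitesimally rigid and not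
uniruled, or by isolated points of Hodge loci; the HC-verbatim residue of the line).
[cite: BaldiKlinglerUllmo2024, Thm. 2.3] -/
def Stuck (P : HodgePair n p) : Prop :=
  ∀ Q : HodgePair n p, Relation.ReflTransGen Step P Q →
    ∃ g : Q.X ≅ P.X, Q.c - complexBetti.map g.hom (2 * p) P.c ∈ algebraicClasses Q.X p

/-- **Chain anchor existence in bidegree `(n, p)`** (the card's `C⁺`, one bidegree at a time): every
Hodge pair `(X, c)` with `dim X = n`, `c ∈ H²ᵖ(X(ℂ); ℂ)`, is joined, by a finite chain of hops inside smooth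
projective families carrying a global fibrewise-Hodge class and surgeries by algebraic classes, to a pair
whose class is algebraic.  `∀ n p, ChainAnchorExistenceAt n p` is weaker than `AnchorExistence` (an anchor
datum is a one-hop chain) and equivalent to it modulo the route's other crux `VariationalHodge` (sibling
proof file). [cite: CharlesSchnell2014Notes, Conj. 11.3.1] -/
def ChainAnchorExistenceAt (n p : ℕ) : Prop :=
  ∀ P : HodgePair n p, ChainAnchorAt P

/-- `ChainAnchorExistenceAt` unfolded (by `Iff.rfl`): every pair reaches, by a `Relation.ReflTransGen Step`
chain, a pair with algebraic class. [cite: CharlesSchnell2014Notes, Conj. 11.3.1] -/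
theorem chainAnchorExistenceAt_iff :
    ∀ (n p : ℕ), ChainAnchorExistenceAt n p ↔ ∀ P : HodgePair n p, ∃ Q : HodgePair n p,
      Relation.ReflTransGen Step P Q ∧ Q.c ∈ algebraicClasses Q.X p :=
  fun _ _ ↦ Iff.rfl

/-- The pair carried by the fibre `𝒳_u` of a smooth projective family `f : 𝒳 ⟶ S` of relative dimension
`n` with a global class `A` fibrewise rational of type `(p,p)`: `(𝒳_u, A|_{𝒳_u})` (every rational fibre
of such a family is smooth projective of dimension `n`, `IsSmoothProjectiveFamily.isSmoothProjective`).
[cite: CharlesSchnell2014Notes, Conj. 11.3.1] -/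
def fiberPair {𝒳 S : SchemeOver ℂ} (f : 𝒳 ⟶ S) (hf : IsSmoothProjectiveFamily f n)
    (A : complexBetti 𝒳 (2 * p))
    (hA : ∀ u : ComplexPoints S, IsRationalClass (complexBetti.map (fiberι f u) (2 * p) A) ∧
      IsOfHodgeType n (fiberOver f u) (2 * p) p p (complexBetti.map (fiberι f u) (2 * p) A))
    (u : ComplexPoints S) : HodgePair n p :=
  ⟨fiberOver f u, complexBetti.map (fiberι f u) (2 * p) A, hf.isSmoothProjective u, (hA u).1, (hA u).2⟩

/-- The class of `fiberPair f hf A hA u` is `A|_{𝒳_u}` (by `rfl`). [cite: CharlesSchnell2014Notes, Conj. 11.3.1] -/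
@[simp]
theorem fiberPair_c {𝒳 S : SchemeOver ℂ} (f : 𝒳 ⟶ S) (hf : IsSmoothProjectiveFamily f n)
    (A : complexBetti 𝒳 (2 * p))
    (hA : ∀ u : ComplexPoints S, IsRationalClass (complexBetti.map (fiberι f u) (2 * p) A) ∧
      IsOfHodgeType n (fiberOver f u) (2 * p) p p (complexBetti.map (fiberι f u) (2 * p) A))
    (u : ComplexPoints S) : (fiberPair f hf A hA u).c = complexBetti.map (fiberι f u) (2 * p) A :=
  rfl

/-- The variety of `fiberPair f hf A hA u` is the fibre `𝒳_u` (by `rfl`). [cite: CharlesSchnell2014Notes, Conj. 11.3.1] -/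
@[simp]
theorem fiberPair_X {𝒳 S : SchemeOver ℂ} (f : 𝒳 ⟶ S) (hf : IsSmoothProjectiveFamily f n)
    (A : complexBetti 𝒳 (2 * p))
    (hA : ∀ u : ComplexPoints S, IsRationalClass (complexBetti.map (fiberι f u) (2 * p) A) ∧
      IsOfHodgeType n (fiberOver f u) (2 * p) p p (complexBetti.map (fiberι f u) (2 * p) A))
    (u : ComplexPoints S) : (fiberPair f hf A hA u).X = fiberOver f u :=
  rfl

end Summit.HodgeConjecture.HodgeConjecture.Theorems.ChainAnchor

end
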